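import Literature.NumberTheory.Automorphic.CompletedCohomology
import Literature.NumberTheory.Automorphic.CompletedCohomologyHeckeAlgebraGLn
import Literature.NumberTheory.Automorphic.StrongApproximationSL2
import HarnessLib

/-!
# `GL₂(K)`-invariant functions on `GL₂(𝔸_K^∞) ⧸ U` factor through the determinant; Hecke
# operators on them are multiples of translations

Topic `NumberTheory/Automorphic`; namespace `Literature.NumberTheory.Automorphic.BigHeckeGLn`;
theorems only.  Proof file supporting the named fact
`Literature.NumberTheory.Automorphic.hidaControl_dominantOrdinaryPoint` (Hida's control theorem in
consequence form): the degree-`0` analysis of the tree's all-degree ordinary Hecke algebra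
`𝕋^{S,ord}(𝒰)` (`OrdinaryCompletedCohomologyGL`).  In degree `0`,
`H⁰(X_U, M) = Fun(GL₂(K) \ GL₂(𝔸_K^∞) ⧸ U, M)`, and by strong approximation for `SL₂`
(`StrongApproximationSL2`, PROVED in the tree) these are functions of the determinant; hence a
Hecke operator `[U t U]` acts on them as `#(U t U / U) · (translation by t)`, which for
`t = diag(ϖ_v, 1)`, `v ∣ p`, is divisible by `p` — so `U_{v,1}` is nilpotent on
`H⁰(X_{U(r)}, ℤ/p^s)` and the ordinary part of the Hida tower has no degree-`0` component
(cf. [KhareThorne2017, §6.3]: `H^i_ord(U)` is built from `H_{d-i}`; [Hida1994AIF, §2]: only the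
degree `q = r₁ + r₂` carries the nearly ordinary part).  This file proves the group-theoretic half:

* `exists_globalEmbedding_toGL_mul_mul_eq_of_det_eq` — **for an open `U ≤ GL₂(𝔸_K^∞)`, two
  elements with the same determinant satisfy `g' = ι(γ) g u` with `γ ∈ SL₂(K)`, `u ∈ U`**
  (`g' g⁻¹ ∈ SL₂(𝔸_K^∞) = SL₂(K) · (SL₂ ∩ g U g⁻¹)`, `exists_specialLinearGroup_map_mul_eq`).
* `apply_coe_eq_of_det_eq` — a `GL₂(K)`-invariant function on `GL₂(𝔸_K^∞) ⧸ U`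
  (`ArithmeticQuotient.coeffRepresentation`-invariant, i.e. an element of `H⁰(X_U, M)`) takes the
  same value on cosets of equal determinant.
* `heckeFun_apply_coe_of_forall_coeffRepresentation_eq` — **on invariant functions the Hecke
  operator `[U t U]` is `#(U t U / U) • f(· t)`**: every coset `l t U ⊆ U t U` has
  `f(x l t U) = f(x t l U) = f(x t U)` (equal determinants).
* `heckeFun_pow_apply_coe_of_forall_coeffRepresentation_eq` — hence
  `[U t U]^m f (xU) = #(U t U / U)^m • f(x t^m U)`.

## References

* D. Bump, *Automorphic forms and representations* (1997), Thm. 3.3.1 (strong approximation)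
  [Bump1997].
* C. Khare, J. A. Thorne, *Potential automorphy and the Leopoldt conjecture*, Amer. J. Math. 139
  (2017), §6.2–6.3 (arXiv:1409.7007, held). [KhareThorne2017]
* H. Hida, *p-adic ordinary Hecke algebras for GL(2)*, Ann. Inst. Fourier 44 (1994), §2
  (held). [Hida1994AIF]
-/

noncomputable section

open scoped NumberField MatrixGroups
open IsDedekindDomain
open Matrix.SpecialLinearGroup (toGL)

namespace Literature.NumberTheory.Automorphic.BigHeckeGLn

variable {K : Type} [Field K] [NumberField K]

/-- `toGL` commutes with change of rings (restated; `StrongApproximationGL2.toGL_map`). [folklore] -/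
private theorem toGL_map' (f : K →+* FiniteAdeleRing (𝓞 K) K) (γ : SL(2, K)) :
    toGL (Matrix.SpecialLinearGroup.map f γ) = Matrix.GeneralLinearGroup.map f (toGL γ) :=
  Units.ext rfl

/-- **Elements of `GL₂(𝔸_K^∞)` with the same determinant differ by a global `SL₂(K)` element on
the left and a level element on the right**: for an open subgroup `U` and `det g = det g'` there
are `γ ∈ SL₂(K)` and `u ∈ U` with `g' = ι(γ) g u`.  Strong approximation for `SL₂`
(`exists_specialLinearGroup_map_mul_eq`) applied to `g' g⁻¹ ∈ SL₂(𝔸_K^∞)` and the open subgroup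
`SL₂ ∩ g U g⁻¹`. [cite: Bump1997, Thm. 3.3.1] -/
theorem exists_globalEmbedding_toGL_mul_mul_eq_of_det_eq (U : Subgroup (FiniteAdelicGL 2 K))
    (hU : IsOpen (U : Set (FiniteAdelicGL 2 K))) {g g' : FiniteAdelicGL 2 K}
    (h : Matrix.GeneralLinearGroup.det g = Matrix.GeneralLinearGroup.det g') :
    ∃ (γ : SL(2, K)) (u : FiniteAdelicGL 2 K), u ∈ U ∧
      globalEmbedding 2 K (toGL γ) * g * u = g' := by
  have hdet : Matrix.GeneralLinearGroup.det (g' * g⁻¹) = 1 := by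
    rw [map_mul, map_inv, ← h, mul_inv_cancel]
  obtain ⟨s, hs⟩ : g' * g⁻¹ ∈ Set.range
      (toGL : SL(2, FiniteAdeleRing (𝓞 K) K) → FiniteAdelicGL 2 K) := by
    rw [Matrix.SpecialLinearGroup.range_toGL]
    exact hdet
  set U' : Subgroup (FiniteAdelicGL 2 K) := U.comap (MulAut.conj g⁻¹).toMonoidHom with hU'
  have hU'mem : ∀ x, x ∈ U' ↔ g⁻¹ * x * g ∈ U := fun x => by
    rw [hU', Subgroup.mem_comap, MulEquiv.coe_toMonoidHom, MulAut.conj_apply, inv_inv]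
  have hU'open : IsOpen (U' : Set (FiniteAdelicGL 2 K)) := by
    have hc : Continuous fun x : FiniteAdelicGL 2 K => g⁻¹ * x * g :=
      (continuous_const.mul continuous_id).mul continuous_const
    have h' := hU.preimage hc
    convert h' using 1
    ext x
    exact hU'mem x
  have hU'' : IsOpen ((U'.comap (toGL : SL(2, FiniteAdeleRing (𝓞 K) K) →*
      FiniteAdelicGL 2 K)) : Set SL(2, FiniteAdeleRing (𝓞 K) K)) :=
    hU'open.preimage Matrix.SpecialLinearGroup.continuous_toGL
  obtain ⟨γ, u₁, hu₁, hsu⟩ := exists_specialLinearGroup_map_mul_eq (𝓞 K) K _ hU'' s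
  refine ⟨γ, g⁻¹ * toGL u₁ * g, (hU'mem _).1 hu₁, ?_⟩
  have hγ : globalEmbedding 2 K (toGL γ) =
      toGL (Matrix.SpecialLinearGroup.map (algebraMap K (FiniteAdeleRing (𝓞 K) K)) γ) := by
    rw [toGL_map']
    rfl
  calc globalEmbedding 2 K (toGL γ) * g * (g⁻¹ * toGL u₁ * g)
      = toGL (Matrix.SpecialLinearGroup.map (algebraMap K (FiniteAdeleRing (𝓞 K) K)) γ) *
          toGL u₁ * g := by rw [hγ]; group
    _ = toGL s * g := by rw [← map_mul, hsu]
    _ = g' := by rw [hs, inv_mul_cancel_right]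

variable {k : Type} [CommRing k] {M : Type} [AddCommGroup M] [Module k M]

/-- **`GL₂(K)`-invariant functions on `GL₂(𝔸_K^∞) ⧸ U` factor through the determinant**: an
element of `H⁰(X_U, M) = Fun(𝒢 ⧸ U, M)^{GL₂(K)}` (invariant under the left-translation
representation `ArithmeticQuotient.coeffRepresentation`) takes equal values on cosets `gU`, `g'U`
with `det g = det g'`. [cite: Bump1997, Thm. 3.3.1] -/
theorem apply_coe_eq_of_det_eq {U : Subgroup (FiniteAdelicGL 2 K)}
    (hU : IsOpen (U : Set (FiniteAdelicGL 2 K))) {f : (FiniteAdelicGL 2 K ⧸ U) → M}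
    (hf : ∀ γ : GL (Fin 2) K,
      ArithmeticQuotient.coeffRepresentation k (globalEmbedding 2 K) U M γ f = f)
    {g g' : FiniteAdelicGL 2 K}
    (h : Matrix.GeneralLinearGroup.det g = Matrix.GeneralLinearGroup.det g') :
    f (g : FiniteAdelicGL 2 K ⧸ U) = f (g' : FiniteAdelicGL 2 K ⧸ U) := by
  obtain ⟨γ, u, hu, hg'⟩ := exists_globalEmbedding_toGL_mul_mul_eq_of_det_eq U hU h
  have hinv : f ((globalEmbedding 2 K (toGL γ))⁻¹ • ((g' : FiniteAdelicGL 2 K ⧸ U))) =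
      f (g' : FiniteAdelicGL 2 K ⧸ U) := by
    have h1 := congrFun (hf (toGL γ)) (g' : FiniteAdelicGL 2 K ⧸ U)
    rwa [ArithmeticQuotient.coeffRepresentation_apply] at h1
  rw [← hinv, ← hg', QuotientGroup.mk_mul_of_mem _ hu, MulAction.Quotient.smul_coe, smul_eq_mul,
    ← mul_assoc, inv_mul_cancel, one_mul]

/-- **On invariant functions the Hecke operator `[U t U]` is `#(U t U / U) • f(· t)`.**  For `f`
invariant under `GL₂(K)` and `U` open, `(T_t f)(xU) = ∑_{d ∈ UtU/U} f(x • d)` and every term equals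
`f(x t U)`: `d = l t U`, `l ∈ U`, and `det(x l t) = det(x t l)` with `x t l U = x t U`.
[cite: KhareThorne2017, §6.2] -/
theorem heckeFun_apply_coe_of_forall_coeffRepresentation_eq {U : Subgroup (FiniteAdelicGL 2 K)}
    (hU : IsOpen (U : Set (FiniteAdelicGL 2 K))) (t : FiniteAdelicGL 2 K)
    {f : (FiniteAdelicGL 2 K ⧸ U) → M}
    (hf : ∀ γ : GL (Fin 2) K,
      ArithmeticQuotient.coeffRepresentation k (globalEmbedding 2 K) U M γ f = f)
    (x : FiniteAdelicGL 2 K) (hfin : (ArithmeticQuotient.doubleCosetQuot U t).Finite) :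
    ArithmeticQuotient.heckeFun k U t M f (x : FiniteAdelicGL 2 K ⧸ U) =
      hfin.toFinset.card • f ((x * t : FiniteAdelicGL 2 K) : FiniteAdelicGL 2 K ⧸ U) := by
  rw [ArithmeticQuotient.heckeFun_apply_coe k U M t f x hfin, ← Finset.sum_const]
  refine Finset.sum_congr rfl fun d hd => ?_
  obtain ⟨l, rfl⟩ := (Set.Finite.mem_toFinset hfin).1 hd
  change f (x • ((l : FiniteAdelicGL 2 K) • (t : FiniteAdelicGL 2 K ⧸ U))) = _
  rw [MulAction.Quotient.smul_coe, MulAction.Quotient.smul_coe, smul_eq_mul, smul_eq_mul,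
    ← QuotientGroup.mk_mul_of_mem (x * t) l.2]
  refine apply_coe_eq_of_det_eq hU hf ?_
  simp only [map_mul]
  rw [mul_assoc, mul_comm (Matrix.GeneralLinearGroup.det (l : FiniteAdelicGL 2 K))]

/-- The Hecke operator preserves invariance (it commutes with the `GL₂(K)`-action,
`ArithmeticQuotient.heckeFun_coeffRepresentation`). [folklore] -/
theorem forall_coeffRepresentation_heckeFun_eq {U : Subgroup (FiniteAdelicGL 2 K)}
    (t : FiniteAdelicGL 2 K) {f : (FiniteAdelicGL 2 K ⧸ U) → M}
    (hf : ∀ γ : GL (Fin 2) K,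
      ArithmeticQuotient.coeffRepresentation k (globalEmbedding 2 K) U M γ f = f)
    (γ : GL (Fin 2) K) :
    ArithmeticQuotient.coeffRepresentation k (globalEmbedding 2 K) U M γ
      (ArithmeticQuotient.heckeFun k U t M f) = ArithmeticQuotient.heckeFun k U t M f := by
  rw [← ArithmeticQuotient.heckeFun_coeffRepresentation, hf]

/-- **Powers of the Hecke operator on invariant functions**:
`[U t U]^m f (xU) = #(U t U / U)^m • f(x t^m U)`. [folklore] -/
theorem heckeFun_pow_apply_coe_of_forall_coeffRepresentation_eq {U : Subgroup (FiniteAdelicGL 2 K)}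
    (hU : IsOpen (U : Set (FiniteAdelicGL 2 K))) (t : FiniteAdelicGL 2 K)
    (hfin : (ArithmeticQuotient.doubleCosetQuot U t).Finite) (m : ℕ)
    {f : (FiniteAdelicGL 2 K ⧸ U) → M}
    (hf : ∀ γ : GL (Fin 2) K,
      ArithmeticQuotient.coeffRepresentation k (globalEmbedding 2 K) U M γ f = f)
    (x : FiniteAdelicGL 2 K) :
    (ArithmeticQuotient.heckeFun k U t M ^ m) f (x : FiniteAdelicGL 2 K ⧸ U) =
      hfin.toFinset.card ^ m • f ((x * t ^ m : FiniteAdelicGL 2 K) : FiniteAdelicGL 2 K ⧸ U) := by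
  induction m generalizing f x with
  | zero => simp
  | succ m ih =>
    rw [pow_succ, Module.End.mul_apply,
      ih (forall_coeffRepresentation_heckeFun_eq t hf),
      heckeFun_apply_coe_of_forall_coeffRepresentation_eq hU t hf _ hfin, smul_smul, ← pow_succ,
      mul_assoc, ← pow_succ]

end Literature.NumberTheory.Automorphic.BigHeckeGLn
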